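import Literature.Claims.NS.Belanger2026
import Literature.Claims.NS.ClayPeriodicSerrinBridge
import Summits.NavierStokesRegularity.NavierStokesRegularity.Theorems.SoloSalvageBelanger2026
import HarnessLib

/-!
# C172 `Belanger2026` — refuter-of-record kit (ns-claims-refuter-7 g5): Object B is the claimed theorem

D-0090 NS-CLAIMS SWEEP, cell `ns-claims`, claim C172 (RULINGS v1.47 (1)); skeleton
`Literature.Claims.NS.Belanger2026` (ns-claims-typist-5 g7, p548235, sha16 `e9a9d13442151680`, 418 l.);
text of record Zenodo 21046255 = v2.1.2 «JVE-MB-NS-PROBLEM-B_T3_Rigidity_Journal_v2.1.2.pdf», sha16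
`4b403f1e2f5a943e`, 60 pp., PDF page = printed page (census pin `census/texts/Belanger2026/`; «p.N l.M» =
line M of `pNNN.txt`).

**Where the typed chain breaks.** Thm 1.1 p.7 l.3–7 prints two sentences: the RIGIDITY face
(`ClaimedRigidity`, over Definition 3.1 p.13 l.54–72: divergence-free, zero mean, both suprema (6) finite,
solves (1)) and the REGULARITY face (`ClaimedTheorem` = Clay (B) on mean-zero data), joined by
«Equivalently» = §4, Proposition 4.2 (Object B) p.15 l.93 – p.16 l.10: «Under the same hypothesis [a smooth
solution first loses regularity at T⋆ < ∞] there exists a nontrivial bounded ancient suitable weak solution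
U^T_∞ on the fixed torus … in the sense of Definition 3.1, with sup_{s≤0}‖U^T_∞(·,s)‖_∞ ≤ M_u,
sup_{s≤0}‖ω^T_∞(·,s)‖_∞ =: M < ∞», whose proof (p.17 l.53–59; Step B1 p.18 l.13–17; Step B2 l.18–20)
asserts for the blowing-up `u` on `[0,T⋆)` ONE pair of finite bounds `‖u(·,t)‖_∞ ≤ M_u`, `‖ω(·,t)‖_∞ ≤ M`
(«the two finite suprema that Definition 3.1 requires … hence uniform in k») — against its own Step A1
p.16 l.48–50 «M_k := ‖u(·,t_k)‖_∞ → ∞». Recorded here, Theorems-side, by name against the landed skeleton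
and the landed TRUE-column file of ns-claims-salvage-p3 g5 (p548026,
`…Theorems.Belanger2026Salvage.ancient_meanZero_eq_zero_of_norm_le`):

* the RIGIDITY face is TRUE in kernel — `claimedRigidity_holds'` (energy identity + torus Poincaré on the
  mean-zero subspace + the `L∞` ceiling: every member of Def 3.1 vanishes for `t < 0`,
  `isBoundedAncient_eq_zero`); hence EVERY binder of the rigidity chain consumed by `claim_of_steps`
  (Lemma 9.1, 9.3, 3.5, 11.1, Thm 12.1, Lemmas 13.1/13.2, Thm 13.10, and Prop 4.3) holds in kernel
  (`step_L91_holds'` … `step_T1310_holds'`, `step_P43_holds'`) — all load sits on Object B;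
* Object B under the REF's ONE charitable retype (`Step_P42c`: blow-up ⇒ SOME nontrivial member of
  Def 3.1) is EQUIVALENT to the claimed theorem and to Clay (B), unconditionally:
  `step_P42c_iff_claimedTheorem'`, `step_P42c_iff_clayB`; it FAILS EXACTLY on a blow-up
  (`not_step_P42c_iff_exists_blowup`); with every other binder discharged, `claimedTheorem_iff_step_P42c`;
* Object B AS PRINTED (`Step_P42`, bounds `M_u`, `M` of the blowing-up `u`) and its proof's bounds sentence
  (`Step_B1`) are equivalent to Clay (B) by the skeleton's own `step_P42_iff_claimedTheorem` /
  `step_B1_iff_claimedTheorem` (`step_P42_iff_clayB`, `step_B1_iff_clayB`); the velocity half of the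
  bounds sentence is refuted on every blow-up by the tree's Serrin-type continuation
  (`not_uniform_velBound_of_isBlowup`: `sup_{[0,T⋆)}‖u‖_∞ = ∞`, the print's own Step A1), as the
  vorticity half is by BKM in the skeleton (`not_uniform_vortBound_of_isBlowup`).

HEAD of the VERDICT (refuter of record; REF-1 g7 F-PASS 16:46:19Z concurs): the bounds sentence AS USED,
`Literature.Claims.NS.Belanger2026.Step_B1` (skeleton l.196; print p.17 l.57–59, Step B1 p.18 l.13–17, Step B2
l.18–20), class vacuous (circular) BY the skeleton's own landed `step_B1_iff_claimedTheorem` (p548235); the two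
typed faces of Prop 4.2's statement (`Step_P42`, `Step_P42c`) fall with it (`step_B1_iff_step_P42`,
`step_B1_iff_step_P42c`). This file is the Theorems-side ADDENDUM record (support theorems by name), not the
«by» slot. Names primed (`…'`) where the custodian's append-only rev 2 of the skeleton declares an in-file twin.

Classification (cell grammar): vacuous (circular) — ROUTE 5b, precedents #3 `Kyritsis2026`, #151
`Cox2025`. Nothing degenerate is used: no rest state, no zero datum, no junk model. Axioms: `propext`,
`Classical.choice`, `Quot.sound` only. WHAT THIS IS NOT: not a claim about NS regularity or blow-up; not
a claim about any author beyond the typed locator.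
-/

set_option linter.dupNamespace false

open Set MeasureTheory Filter Topology

namespace Summit.NavierStokesRegularity.NavierStokesRegularity.Theorems.Belanger2026

open Literature.Analysis Literature.Analysis.FunctionSpaces
  Literature.Claims.NS.ClayVariants Literature.Claims.NS.Belanger2026
open Literature.Analysis.FluidPDE (torusVorticitySqAt)
open Literature.Claims.NS.Higgins2026 (T3 E3)
open Literature.Claims.NS.Lietz2026 (IsDatum vort)

noncomputable section

/-! ## §1 The rigidity face (Thm 1.1 sentence 1) is TRUE in kernel -/

/-- **Every member of Definition 3.1 vanishes on `t < 0`** (classical grain, `ν > 0`): restrict the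
solution to `(−∞, t] ⊆ (−∞, 0)` and apply the landed torus Liouville theorem of the salvage file (energy
identity `Ė = −ν‖∇u‖²`, Poincaré `4π²∫|u|² ≤ ‖∇u‖²` on mean-zero slices, ceiling `E ≤ ½M_u²`: backward
exponential growth unless `E ≡ 0`). [cite: Belanger2026, Def 3.1 p.13 l.54–72; Lemma 13.12 p.34 l.46–58; Thm 13.10 p.33 l.44–46] -/
theorem isBoundedAncient_eq_zero {ν : ℝ} (hν : 0 < ν) {U : ℝ → T3 → E3} {P : ℝ → T3 → ℝ}
    (hU : IsBoundedAncient ν U P) : ∀ t : ℝ, t < 0 → U t = 0 := by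
  intro t ht
  obtain ⟨Mu, hMu⟩ := hU.velBound
  have hsol : Torus.IsClassicalNSSolutionOn (Iic t) ν 0 U P :=
    hU.solves.mono (Iic_subset_Iio.2 ht) (uniqueDiffOn_Iic t)
  exact Belanger2026Salvage.ancient_meanZero_eq_zero_of_norm_le hν hsol
    (fun s hs => hU.zeroMean s ((mem_Iic.1 hs).trans ht.le))
    (fun s hs x => hMu s ((mem_Iic.1 hs).trans ht.le) x) t self_mem_Iic

/-- **`ClaimedRigidity` HOLDS** (Thm 1.1 sentence 1 p.7 l.3–5 over Def 3.1 as typed): there is no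
nontrivial bounded ancient (classical, mean-zero) solution on the fixed torus. The rigidity face is a
DISCHARGED face; all load of the row sits on the «Equivalently» (Object B).
[cite: Belanger2026, Thm 1.1 p.7 l.3–5; Thm 13.10 p.33 l.44–46] -/
theorem claimedRigidity_holds' : ClaimedRigidity :=
  fun _ν hν _U _P hU ⟨t, ht, hne⟩ => hne (isBoundedAncient_eq_zero hν hU t ht)

/-! ## §2 Object B ⇔ the claimed theorem ⇔ Clay (B) -/

/-- **`Step_P42c ↔ ClaimedTheorem`, unconditionally** (Prop 4.2 p.15 l.93 – p.16 l.10 under the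
REF's one charitable retype «blow-up ⇒ some nontrivial member of Def 3.1»; binder 1 of `claim_of_steps`):
the skeleton's `step_P42c_iff_claimedTheorem_of_rigidity` fed with `claimedRigidity_holds'`. Object B
restates the regularity face it is meant to prove. [cite: Belanger2026, Prop 4.2 p.15 l.93 – p.16 l.10; Proof of Thm 1.1 p.35 l.41–53] -/
theorem step_P42c_iff_claimedTheorem' : Step_P42c ↔ ClaimedTheorem :=
  step_P42c_iff_claimedTheorem_of_rigidity claimedRigidity_holds'

/-- `Step_P42c ↔` Clay (B). [cite: Belanger2026, Prop 4.2 p.15 l.93 – p.16 l.10] [cite: FeffermanClay2006, (B) p. 2] -/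
theorem step_P42c_iff_clayB : Step_P42c ↔ clayPeriodic.Regularity :=
  step_P42c_iff_claimedTheorem'.trans claimedTheorem_iff_clayB

/-- `Step_P42` (Object B AS PRINTED, bounds of the blowing-up `u`) `↔` Clay (B) (skeleton iff + Clay link).
[cite: Belanger2026, Prop 4.2 p.15 l.93 – p.16 l.10] [cite: FeffermanClay2006, (B) p. 2] -/
theorem step_P42_iff_clayB : Step_P42 ↔ clayPeriodic.Regularity :=
  step_P42_iff_claimedTheorem.trans claimedTheorem_iff_clayB

/-- `Step_B1` (the bounds sentence of Prop 4.2's proof, p.17 l.53–59 / Step B1 p.18 l.13–17) `↔` Clay (B).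
[cite: Belanger2026, proof of Prop 4.2 p.17 l.53–59; Step B1 p.18 l.13–17] [cite: FeffermanClay2006, (B) p. 2] -/
theorem step_B1_iff_clayB : Step_B1 ↔ clayPeriodic.Regularity :=
  step_B1_iff_claimedTheorem.trans claimedTheorem_iff_clayB

/-- The three typed faces of Object B coincide in kernel: `Step_P42 ↔ Step_P42c`.
[cite: Belanger2026, Prop 4.2 p.15 l.93 – p.16 l.10] -/
theorem step_P42_iff_step_P42c : Step_P42 ↔ Step_P42c :=
  step_P42_iff_claimedTheorem.trans step_P42c_iff_claimedTheorem'.symm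

/-- … and `Step_B1 ↔ Step_P42c`. [cite: Belanger2026, Step B1 p.18 l.13–17] -/
theorem step_B1_iff_step_P42c : Step_B1 ↔ Step_P42c :=
  step_B1_iff_claimedTheorem.trans step_P42c_iff_claimedTheorem'.symm

/-- The proof's bounds sentence and the statement as printed coincide in kernel: `Step_B1 ↔ Step_P42`.
[cite: Belanger2026, Step B1 p.18 l.13–17; Prop 4.2 p.15 l.93 – p.16 l.10] -/
theorem step_B1_iff_step_P42 : Step_B1 ↔ Step_P42 :=
  step_B1_iff_claimedTheorem.trans step_P42_iff_claimedTheorem.symm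

/-- **HEAD record on rev 1: `Step_B1` is a consumed binder** — the bounds sentence ALONE yields the claimed
theorem (the skeleton's `step_B1_iff_claimedTheorem`, forward direction; rev 2's in-file `claim_of_step_B1`
is its twin). [cite: Belanger2026, proof of Prop 4.2 p.17 l.53–59; Step B1 p.18 l.13–17] -/
theorem claim_of_step_B1' (hB1 : Step_B1) : ClaimedTheorem := step_B1_iff_claimedTheorem.1 hB1

/-- Clay (B) from the bounds sentence alone. [cite: FeffermanClay2006, (B) p. 2] [cite: Belanger2026, Step B1 p.18 l.13–17] -/
theorem clayB_of_step_B1 (hB1 : Step_B1) : clayPeriodic.Regularity := step_B1_iff_clayB.1 hB1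

/-- **The bounds sentence fails EXACTLY on a blow-up**: `¬ Step_B1 ↔` some smooth mean-zero datum blows up
(so no instance can be exhibited short of refuting Clay (B): the step is unrefutable AND unprovable short of
the claim — circular). [cite: Belanger2026, proof of Prop 4.2 p.17 l.53–59; Step B1 p.18 l.13–17] -/
theorem not_step_B1_iff_exists_blowup :
    ¬ Step_B1 ↔ ∃ ν : ℝ, 0 < ν ∧ ∃ (u : ℝ → T3 → E3) (p : ℝ → T3 → ℝ) (T : ℝ), IsBlowup ν u p T := by
  rw [step_B1_iff_claimedTheorem, claimedTheorem_iff_noBlowup]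
  push Not
  rfl

/-- **Object B fails EXACTLY on a blow-up**: `¬ Step_P42c ↔` some smooth mean-zero datum blows up.
[cite: Belanger2026, Prop 4.2 p.15 l.93 – p.16 l.10] -/
theorem not_step_P42c_iff_exists_blowup :
    ¬ Step_P42c ↔ ∃ ν : ℝ, 0 < ν ∧ ∃ (u : ℝ → T3 → E3) (p : ℝ → T3 → ℝ) (T : ℝ), IsBlowup ν u p T := by
  rw [step_P42c_iff_claimedTheorem', claimedTheorem_iff_noBlowup]
  push Not
  rfl

/-- `¬ Step_P42 ↔` some smooth mean-zero datum blows up. [cite: Belanger2026, Prop 4.2 p.15 l.93 – p.16 l.10] -/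
theorem not_step_P42_iff_exists_blowup :
    ¬ Step_P42 ↔ ∃ ν : ℝ, 0 < ν ∧ ∃ (u : ℝ → T3 → E3) (p : ℝ → T3 → ℝ) (T : ℝ), IsBlowup ν u p T := by
  rw [step_P42_iff_step_P42c, not_step_P42c_iff_exists_blowup]

/-- **The velocity half of the bounds sentence fails on every blow-up** (`M_u = sup_{[0,T⋆)}‖u‖_∞` is not
finite — the print's own Step A1 p.16 l.48–50 «M_k := ‖u(·,t_k)‖_∞ → ∞»): a uniform velocity bound on
`[0, T⋆)` continues `u` to a closed window `[0, T']`, `T' > T⋆` (tree door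
`torus_classicalNS_continuation_of_velocityBound_anyMean`, Serrin-type), against `IsBlowup`'s maximality.
[cite: Belanger2026, Step A1 p.16 l.46–62; proof of Prop 4.2 p.17 l.53–59] -/
theorem not_uniform_velBound_of_isBlowup {ν : ℝ} (hν : 0 < ν) {u : ℝ → T3 → E3} {p : ℝ → T3 → ℝ}
    {T : ℝ} (h : IsBlowup ν u p T) {Mu : ℝ} (hMu : ∀ t ∈ Ico 0 T, ∀ x, ‖u t x‖ ≤ Mu) : False := by
  obtain ⟨hT, -, hcl, hmax⟩ := h
  obtain ⟨T', hTT', u', p', hcl', hagree⟩ :=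
    torus_classicalNS_continuation_of_velocityBound_anyMean hν hT hcl hMu
  exact absurd hTT' (not_lt.2 (hmax T' u' p' hcl' (hagree 0 ⟨le_rfl, hT⟩)).le)

/-- **On every blow-up BOTH halves of the bounds sentence fail separately** (neither `M_u` nor `M` is finite
for the blowing-up `u` on `[0,T⋆)`): velocity by Serrin-type continuation, vorticity by BKM.
[cite: Belanger2026, proof of Prop 4.2 p.17 l.57–59; Step A1 p.16 l.48–50] -/
theorem bounds_sentence_fails_of_isBlowup {ν : ℝ} (hν : 0 < ν) {u : ℝ → T3 → E3} {p : ℝ → T3 → ℝ}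
    {T : ℝ} (h : IsBlowup ν u p T) :
    (¬ ∃ Mu : ℝ, ∀ t ∈ Ico 0 T, ∀ x, ‖u t x‖ ≤ Mu) ∧
      ¬ ∃ M : ℝ, ∀ t ∈ Ico 0 T, ∀ x, torusVorticitySqAt (u t) x ≤ M ^ 2 :=
  ⟨fun ⟨_, hMu⟩ => not_uniform_velBound_of_isBlowup hν h hMu,
    fun ⟨_, hM⟩ => not_uniform_vortBound_of_isBlowup hν h hM⟩

/-! ## §3 Every other binder of `claim_of_steps` holds in kernel (TRUE column, by rigidity) -/

/-- `∂ᵢ 0 = 0` on the torus. [folklore] -/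
theorem partialDeriv_zero_fun (i : Fin 3) : Torus.partialDeriv i (0 : T3 → E3) = 0 := by
  funext x
  simp [Torus.partialDeriv, Torus.lineDeriv]

/-- `|ω|²` of the zero field vanishes. [folklore] -/
theorem torusVorticitySqAt_zero (x : T3) : torusVorticitySqAt (0 : T3 → E3) x = 0 := by
  simp [torusVorticitySqAt, partialDeriv_zero_fun]

/-- `Ω(0) = 0`. [cite: Belanger2026, (4) p.7 l.52–72] -/
theorem enstrophy_zero' : enstrophy (0 : T3 → E3) = 0 := by
  simp [enstrophy, torusVorticitySqAt_zero]

/-- `P(0) = 0`. [cite: Belanger2026, (4) p.7 l.52–72] -/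
theorem production_zero' : production (0 : T3 → E3) = 0 := by
  simp [production, partialDeriv_zero_fun]

/-- `G(0) = 0`. [cite: Belanger2026, (4) p.7 l.52–72] -/
theorem palinstrophy_zero' : palinstrophy (0 : T3 → E3) = 0 := by
  simp [palinstrophy, partialDeriv_zero_fun, torusVorticitySqAt_zero]

/-- A member of Def 3.1 has a finite backward budget for any functional vanishing at `0`: the budget is `0`.
[cite: Belanger2026, Lemma 9.3 p.26 l.25–42] -/
theorem hasFiniteBackwardBudget_of_isBoundedAncient {ν : ℝ} (hν : 0 < ν) {U : ℝ → T3 → E3}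
    {P : ℝ → T3 → ℝ} (hU : IsBoundedAncient ν U P) {F : (T3 → E3) → ℝ} (hF : F 0 = 0) :
    HasFiniteBackwardBudget F U := by
  refine ⟨0, fun a b hab hb => ?_⟩
  have hz := isBoundedAncient_eq_zero hν hU
  have heq : ∫ t in a..b, F (U t) = ∫ _t in a..b, (0 : ℝ) := by
    refine intervalIntegral.integral_congr fun t ht => ?_
    rw [uIcc_of_le hab.le] at ht
    show F (U t) = 0
    rw [hz t (ht.2.trans_lt hb), hF]
  rw [heq, intervalIntegral.integral_zero]

/-- **Lemma 9.1 (energy ceiling) HOLDS**: `E(t) ≤ ½ M_u²` (unit torus). [cite: Belanger2026, Lemma 9.1 p.25 l.50–70] -/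
theorem step_L91_holds' : Step_L91 := by
  intro ν _hν U P hU Mu hMu t ht
  exact Belanger2026Salvage.kineticEnergy_le_of_norm_le (hU.solves.smooth_velocity.isSmooth_slice (mem_Iio.2 ht)) (hMu t ht.le)

/-- **Lemma 9.3 (backward enstrophy budget) HOLDS** (the budget is `0`). [cite: Belanger2026, Lemma 9.3 p.26 l.25–42] -/
theorem step_L93_holds' : Step_L93 :=
  fun _ν hν _U _P hU => hasFiniteBackwardBudget_of_isBoundedAncient hν hU enstrophy_zero'

/-- **Lemma 3.5 (pointwise production bound) HOLDS** on the class (both sides vanish for `t < 0`).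
[cite: Belanger2026, Lemma 3.5 p.14 l.188] -/
theorem step_L35_holds' : Step_L35 := by
  intro ν hν U P hU M _hM _hω t ht
  rw [isBoundedAncient_eq_zero hν hU t ht, production_zero', enstrophy_zero']
  simp

/-- **Lemma 11.1 (bridge) HOLDS** (the `|P|` budget is `0`). [cite: Belanger2026, Lemma 11.1 p.27 l.24–40] -/
theorem step_L111_holds' : Step_L111 :=
  fun _ν hν _U _P hU _ =>
    hasFiniteBackwardBudget_of_isBoundedAncient hν hU (F := fun v => |production v|)
      (by simp [production_zero'])

/-- **Theorem 12.1 (finite backward palinstrophy budget) HOLDS** (the budget is `0`).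
[cite: Belanger2026, Thm 12.1 p.28 l.17–40] -/
theorem step_T121_holds' : Step_T121 :=
  fun _ν hν _U _P hU _ => hasFiniteBackwardBudget_of_isBoundedAncient hν hU palinstrophy_zero'

/-- **Lemmas 13.1/13.2 (`Ω(−σ) → 0`) HOLD** (`Ω(t) = 0` for every `t < 0`).
[cite: Belanger2026, Lemma 13.1 p.30 l.26; Lemma 13.2 p.30 l.59] -/
theorem step_L132_holds' : Step_L132 := by
  intro ν hν U P hU _
  refine (tendsto_const_nhds (x := (0 : ℝ))).congr' ?_
  filter_upwards [eventually_lt_atBot (0 : ℝ)] with t ht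
  rw [isBoundedAncient_eq_zero hν hU t ht, enstrophy_zero']

/-- **Theorem 13.10 (as used) HOLDS** — indeed from the class alone. [cite: Belanger2026, Thm 13.10 p.33 l.44–54] -/
theorem step_T1310_holds' : Step_T1310 :=
  fun ν hν U P hU _ _ => claimedRigidity_holds' ν hν U P hU

/-- **Proposition 4.3 (as typed) HOLDS** vacuously: the class has no nontrivial member.
[cite: Belanger2026, Prop 4.3 p.19 l.2–70] -/
theorem step_P43_holds' : Step_P43 :=
  fun ν hν U P hU hnt => absurd hnt (claimedRigidity_holds' ν hν U P hU)

/-! ## §4 All load on binder 1: the composition with every other binder discharged -/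

/-- **`claim_of_steps` with binders 2–8 discharged in kernel**: Object B (charitable) alone yields the
claimed theorem — the rigidity chain §§9–13 is DECORATION for the composition.
[cite: Belanger2026, Proof of Thm 1.1 p.35 l.41–53] -/
theorem claim_of_step_P42c (h42 : Step_P42c) : ClaimedTheorem :=
  claim_of_steps h42 step_L91_holds' step_L93_holds' step_L35_holds' step_L111_holds' step_T121_holds'
    step_L132_holds' step_T1310_holds'

/-- **`ClaimedTheorem ↔ Step_P42c`**: the printed chain's one undischarged input is its output.
[cite: Belanger2026, Proof of Thm 1.1 p.35 l.41–53; Prop 4.2 p.15 l.93 – p.16 l.10] -/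
theorem claimedTheorem_iff_step_P42c : ClaimedTheorem ↔ Step_P42c :=
  step_P42c_iff_claimedTheorem'.symm

/-- Clay (B) from Object B (charitable retype), through the discharged chain.
[cite: FeffermanClay2006, (B) p. 2] [cite: Belanger2026, Prop 4.2 p.15 l.93 – p.16 l.10] -/
theorem clayB_of_step_P42c (h42 : Step_P42c) : clayPeriodic.Regularity :=
  clayB_of_claimed (claim_of_step_P42c h42)

/-! ## §5 Addendum (append-only): Step B2's passage is itself claim-equivalent -/

/-- **Step B2's passage «hence uniform in k» is itself claim-equivalent**: given the (TRUE) literal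
per-subinterval bounds sentence `Step_B1_lit` (skeleton rev 3 `step_B1_lit_holds`), the inference
`Step_B1_lit → Step_B1` that p.18 l.26–29 asserts without argument holds exactly when the claimed theorem does.
[cite: Belanger2026, Step B2 p.18 l.18–29; proof of Prop 4.2 p.17 l.57–59] -/
theorem stepB2_passage_iff_claimedTheorem (hlit : Step_B1_lit) : (Step_B1_lit → Step_B1) ↔ ClaimedTheorem :=
  ⟨fun h => step_B1_iff_claimedTheorem.1 (h hlit), fun h _ => step_B1_iff_claimedTheorem.2 h⟩

end

end Summit.NavierStokesRegularity.NavierStokesRegularity.Theorems.Belanger2026
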